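import Literature.AlgebraicGeometry.Motives.CurveThroughTwoPoints
import Literature.AlgebraicGeometry.Motives.CurveThroughTwoPointsMainLemma
import Literature.AlgebraicGeometry.Motives.LinesGenerateChowOneSumSq
import Literature.AlgebraicGeometry.Resolution.SmoothOfRegularPerfectField
import Literature.AlgebraicGeometry.Dimension.PointDimension
import Literature.NumberTheory.Transcendental.AnalytificationProper
import Mathlib.RingTheory.KrullDimension.Zero
import HarnessLib

/-!
# Two points of an irreducible variety lie on a curve (Mumford), proved

Topic `Literature/AlgebraicGeometry/Motives`. The named fact
`mumford_smoothCurve_through_two_points` (`Motives/CurveThroughTwoPoints`) is the normalised smooth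
affine complex form of Mumford's lemma (*Abelian Varieties*, §6, Lemma: "Any two points of an
irreducible variety `X` lie on an irreducible curve `C` on `X`"). Its docstring derives it from the
printed lemma in two steps: (1) the printed lemma gives an irreducible closed curve `D ⊆ Z_red`
through `pt a`, `pt b`; (2) the normalisation `C = D^ν → D → Z ⊆ S` is a smooth irreducible affine
curve finite over `D`, and the closed points of `C` over `pt a`, `pt b` are complex points `a'`, `b'`
over `a`, `b` (Liu, *Algebraic Geometry and Arithmetic Curves*, Prop. 2.5.10, Cor. 4.1.30, Ex. 4.2.9,
Cor. 4.3.33). This file PROVES step (2) on the tree's carriers and records the resulting reduction: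

* `exists_smoothCurve_of_height_one` — **step (2)**: for an affine `ℂ`-scheme `S` locally of finite
  type, an integral closed subscheme `W ↪ S`, complex points `a`, `b` of `S` lying on `W` and a point
  `y ∈ W` of dimension one (`Order.height y = 1`) specialising to both, the normalisation
  `C = (closure {y})^ν` (`ProjFamily.curveB`, `Motives/LinesGenerateChowOneSumSq`) with
  `g : C → W ↪ S` is affine, integral, smooth over `ℂ` (regular of dimension one:
  `Resolution.isRegular_normalization_of_dim_le_one`, `Resolution.smooth_of_isRegular_of_perfectField`),
  of topological Krull dimension `1` (`ProjFamily.topologicalKrullDim_curveB`), maps into `W`, and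
  carries complex points over `a` and `b` (`AlgPoints.exists_pt_mem_map_eq`: the finite morphism
  `C^ν → closure {y}` is surjective);
* `mumford_smoothCurve_through_two_points_of_curve_through_two_points` — **the fact follows from
  the printed lemma** in its pointwise scheme form over `ℂ` (for an integral affine `ℂ`-scheme `X`
  locally of finite type and closed points `P ≠ Q` there is `y` with `height y = 1`, `y ⤳ P`,
  `y ⤳ Q`), applied to `Z` with its reduced structure (`ClosedSubvariety.ofPoint S ξ`, `ξ` the generic
  point of `Z`); complex points of `S` are its closed points (`ComplexPoints.equivClosedPoints`), so
  `a ≠ b` gives `pt a ≠ pt b`;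
* `curve_through_two_points` — **step (1), the printed lemma** in that pointwise form, deduced from
  its algebraic heart `TwoPointPencil.exists_prime_le_inf_ringKrullDim_quotient_eq_one`
  (`Motives/CurveThroughTwoPointsMainLemma`: for a finitely generated domain `A` over an
  algebraically closed field of characteristic `0` and maximal ideals `𝔪₁ ≠ 𝔪₂` there is a prime
  `𝔭 ⊆ 𝔪₁ ∩ 𝔪₂` with `dim A/𝔭 = 1`, proved there by an elementary pencil argument replacing
  Mumford's blow-up-and-Bertini proof) through the chart formula `height y = dim Γ(X, ⊤)/𝔭_y`
  (`Dimension/PointDimension`) on the affine integral `X = Spec A`;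
* `mumford_smoothCurve_through_two_points_holds` — **the named fact holds.**

No named fact is introduced.

## References

* [MumfordAV1970] D. Mumford, *Abelian Varieties* (1970), §6, Lemma ("Any two points of an
  irreducible variety lie on an irreducible curve").
* [Liu2002] Q. Liu, *Algebraic Geometry and Arithmetic Curves* (2002), Prop. 2.5.10, Cor. 4.1.30,
  Ex. 4.2.9, Cor. 4.3.33.
* [Fulton1998] W. Fulton, *Intersection Theory*, Example 10.3.2 (the same normalised form: "a
  non-singular curve `T'`, a morphism `T' → T` whose image contains `t₁` and `t₂`").
-/

noncomputable section

universe u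

open CategoryTheory AlgebraicGeometry Order Topology TopologicalSpace

namespace Literature.AlgebraicGeometry.Motives

open Literature.AlgebraicGeometry.Resolution ProjFamily

/-! ### Step (2): normalising an integral curve through the two points -/

section StepTwo

variable {S : SchemeOver ℂ} [IsAffine S.left] [LocallyOfFiniteType S.hom]

/-- **The normalisation of a curve through two complex points** (step (2) of the derivation of
`mumford_smoothCurve_through_two_points`). Let `S` be an affine `ℂ`-scheme locally of finite type,
`W ↪ S` an integral closed subscheme, `a`, `b` complex points of `S` whose underlying points are the
images of `P, Q ∈ W`, and `y ∈ W` a point of dimension one specialising to `P` and to `Q`. Then the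
normalisation `C` of the integral curve `closure {y} ⊆ W` is an affine, irreducible `ℂ`-scheme,
smooth over `ℂ` (a regular curve over a perfect field, Liu Ex. 4.2.9 and Cor. 4.3.33), of
topological Krull dimension `1` (finite over the curve, Liu Prop. 2.5.10 and Cor. 4.1.30), the
morphism `g : C → closure {y} ↪ W ↪ S` lands in `W`, and `C` has complex points `a'`, `b'` over
`a`, `b` (closed points of `C` over `pt a`, `pt b`, Nullstellensatz).
[cite: Liu2002, Prop. 2.5.10, Cor. 4.1.30, Ex. 4.2.9, Cor. 4.3.33] -/
theorem exists_smoothCurve_of_height_one (W : ClosedSubvariety S.left) {y P Q : W.carrier}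
    (hy : height y = 1) (hyP : y ⤳ P) (hyQ : y ⤳ Q) (a b : ComplexPoints S)
    (hP : W.ι.base P = a.pt) (hQ : W.ι.base Q = b.pt) :
    ∃ (C : SchemeOver ℂ) (g : C ⟶ S) (a' b' : ComplexPoints C),
      IsAffine C.left ∧ IrreducibleSpace C.left ∧ AlgebraicGeometry.Smooth C.hom ∧
        topologicalKrullDim C.left = 1 ∧ (∀ c : C.left, g.left.base c ∈ Set.range W.ι.base) ∧
        AlgPoints.map g a' = a ∧ AlgPoints.map g b' = b := by
  -- `W` as a `ℂ`-scheme, locally of finite type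
  let X' : SchemeOver ℂ := Over.mk (W.ι ≫ S.hom)
  haveI hX' : LocallyOfFiniteType X'.hom := inferInstanceAs (LocallyOfFiniteType (W.ι ≫ S.hom))
  -- the curve `D = closure {y}`, its normalisation `C = D^ν` and `g : C → D ↪ W ↪ S`
  let D : ClosedSubvariety X'.left := curveC X' y
  let C : SchemeOver ℂ := curveB X' y
  haveI hfin : IsFinite (normalizationι D.carrier) :=
    isFinite_normalizationι _ NoetherFiniteIntegralClosure_holds (D.ι ≫ X'.hom)
  let j : X' ⟶ S := Over.homMk W.ι rfl
  let g : C ⟶ S := curveν X' y ≫ j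
  -- `C^ν → D` with source spelled `C.left` and `W.ι` with source spelled `X'.left` (so that the
  -- instances below compose syntactically)
  let ν' : C.left ⟶ D.carrier := normalizationι D.carrier
  haveI : IsFinite ν' := inferInstanceAs (IsFinite (normalizationι D.carrier))
  let ιW : X'.left ⟶ S.left := W.ι
  haveI : IsClosedImmersion ιW := inferInstanceAs (IsClosedImmersion W.ι)
  have hg : g.left = (ν' ≫ D.ι) ≫ ιW := rfl
  -- dimension one
  have hdimD : topologicalKrullDim D.carrier = 1 := topologicalKrullDim_curveC hy
  have hdimC : topologicalKrullDim C.left = 1 := topologicalKrullDim_curveB hy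
  -- regular, hence smooth over the perfect field `ℂ`
  have hreg : Scheme.IsRegular C.left :=
    isRegular_normalization_of_dim_le_one _ NoetherFiniteIntegralClosure_holds (D.ι ≫ X'.hom)
      hdimD.le
  haveI : LocallyOfFiniteType C.hom := inferInstanceAs (LocallyOfFiniteType (ν' ≫ D.ι ≫ X'.hom))
  have hsm : AlgebraicGeometry.Smooth C.hom := smooth_of_isRegular_of_perfectField C.hom hreg
  -- affine: `C → S` is an affine morphism to an affine scheme
  haveI : IsAffineHom g.left := by rw [hg]; infer_instance
  have haff : IsAffine C.left := isAffine_of_isAffineHom g.left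
  -- `g` lands in `W`
  have hgW : ∀ c : C.left, g.left.base c ∈ Set.range W.ι.base := fun c =>
    ⟨D.ι.base (ν'.base c), by rw [hg]; rfl⟩
  -- the normalisation is onto `D`: points of `C` over `P` and `Q`
  have hsurj : Function.Surjective ν'.base :=
    (surjective_of_isDominant_of_isClosed_range (normalizationι D.carrier)
      (normalizationι D.carrier).isClosedMap.isClosed_range).surj
  haveI : LocallyOfFiniteType g.left := by rw [hg]; infer_instance
  have lift : ∀ {R : W.carrier} (hyR : y ⤳ R) (e : ComplexPoints S), W.ι.base R = e.pt →
      ∃ e' : ComplexPoints C, AlgPoints.map g e' = e := by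
    intro R hyR e hR
    obtain ⟨c, hc⟩ := hsurj (ClosedSubvariety.ofPointPt y hyR)
    have hgc : g.left.base c = e.pt := by
      rw [← hR, hg]
      change W.ι.base (D.ι.base (ν'.base c)) = _
      rw [hc]
      rfl
    obtain ⟨e', -, he'⟩ :=
      AlgPoints.exists_pt_mem_map_eq g e isClosed_univ (Set.mem_univ c) hgc
    exact ⟨e', he'⟩
  obtain ⟨a', ha'⟩ := lift hyP a hP
  obtain ⟨b', hb'⟩ := lift hyQ b hQ
  exact ⟨C, g, a', b', haff, inferInstance, hsm, hdimC, hgW, ha', hb'⟩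

end StepTwo

/-! ### The reduction of the fact to the printed lemma -/

/-- **`mumford_smoothCurve_through_two_points` follows from Mumford's lemma as printed** (here in
its pointwise scheme form over `ℂ`, for affine integral schemes: given an integral affine
`ℂ`-scheme `X` locally of finite type and two distinct closed points `P ≠ Q` — points of height `0`
in the specialisation order — some point `y` of dimension one specialises to both, i.e. `P` and `Q`
lie on the integral closed curve `closure {y}`; Mumford, *Abelian Varieties*, §6, Lemma). Proof:
give the closed irreducible `Z ⊆ S` its reduced structure `W = closure {ξ} ↪ S` (`ξ` the generic
point of `Z`), an integral affine `ℂ`-scheme locally of finite type; the complex points `a ≠ b`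
have distinct closed underlying points (`ComplexPoints.equivClosedPoints`), which lift to closed
points `P ≠ Q` of `W`; apply the lemma and then `exists_smoothCurve_of_height_one`. The hypothesis
is proved below (`curve_through_two_points`). [cite: MumfordAV1970, §6, Lemma (any two points of an irreducible variety lie on an irreducible curve)] -/
theorem mumford_smoothCurve_through_two_points_of_curve_through_two_points
    (H : ∀ (X : Scheme.{0}) [IsIntegral X] [IsAffine X] (f : X ⟶ Spec (.of ℂ))
      [LocallyOfFiniteType f] (P Q : X), height P = 0 → height Q = 0 → P ≠ Q →
        ∃ y : X, height y = 1 ∧ y ⤳ P ∧ y ⤳ Q) :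
    mumford_smoothCurve_through_two_points := by
  intro S hS hSft Z hZc hZi a b ha hb hab
  -- `Z = closure {ξ}` with its reduced structure `W`
  let ξ : S.left := hZi.genericPoint
  have hξ : closure ({ξ} : Set S.left) = Z := hZi.isGenericPoint_genericPoint hZc
  let W : ClosedSubvariety S.left := ClosedSubvariety.ofPoint S.left ξ
  have hW : Set.range W.ι.base = Z := by
    rw [← hξ]
    exact ClosedSubvariety.range_ofPoint_ι ξ
  -- the closed points `P, Q ∈ W` under `a`, `b`
  have haξ : ξ ⤳ a.pt := specializes_iff_mem_closure.mpr (hξ.symm ▸ ha)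
  have hbξ : ξ ⤳ b.pt := specializes_iff_mem_closure.mpr (hξ.symm ▸ hb)
  let P : W.carrier := ClosedSubvariety.ofPointPt ξ haξ
  let Q : W.carrier := ClosedSubvariety.ofPointPt ξ hbξ
  have hP : W.ι.base P = a.pt := rfl
  have hQ : W.ι.base Q = b.pt := rfl
  have hP0 : height P = 0 := by
    rw [← W.height_ι_base P, hP]
    exact height_eq_zero_of_isClosed_singleton a.isClosed_pt
  have hQ0 : height Q = 0 := by
    rw [← W.height_ι_base Q, hQ]
    exact height_eq_zero_of_isClosed_singleton b.isClosed_pt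
  have hPQ : P ≠ Q := by
    intro h
    apply hab
    apply (ComplexPoints.equivClosedPoints S).injective
    apply Subtype.ext
    rw [ComplexPoints.coe_equivClosedPoints_apply, ComplexPoints.coe_equivClosedPoints_apply,
      ← hP, ← hQ, h]
  -- `W` is an integral affine `ℂ`-scheme locally of finite type: apply the lemma, then step (2)
  haveI : IsAffine W.carrier := isAffine_of_isAffineHom W.ι
  obtain ⟨y, hy, hyP, hyQ⟩ := H W.carrier (W.ι ≫ S.hom) P Q hP0 hQ0 hPQ
  obtain ⟨C, g, a', b', h₁, h₂, h₃, h₄, h₅, h₆, h₇⟩ :=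
    exists_smoothCurve_of_height_one W hy hyP hyQ a b hP hQ
  exact ⟨C, g, a', b', h₁, h₂, h₃, h₄, fun c => hW ▸ h₅ c, h₆, h₇⟩

/-! ### Step (1): the printed lemma, and the fact -/

/-- **Any two closed points of an integral affine variety over `ℂ` lie on an integral curve**
(Mumford, *Abelian Varieties*, §6, Lemma, pointwise affine scheme form): for an integral affine
`ℂ`-scheme `X` locally of finite type and closed points `P ≠ Q` (points of height `0` in Mathlib's
order `a ≤ b ↔ b ⤳ a`) there is a point `y` of height `1` with `y ⤳ P` and `y ⤳ Q`. Proof: with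
`A = Γ(X, ⊤)` (a finitely generated `ℂ`-domain) points of `X` are primes of `A`, specialisation is
inclusion and `height y = dim A/𝔭_y` (`Dimension.Scheme.height_eq_ringKrullDim_quotient_primeIdealOf`);
closed points are maximal ideals (`dim A/𝔭 = 0` forces a field), and
`TwoPointPencil.exists_prime_le_inf_ringKrullDim_quotient_eq_one` gives a prime `𝔮 ⊆ 𝔭_P ∩ 𝔭_Q`
with `dim A/𝔮 = 1`. [cite: MumfordAV1970, §6, Lemma (any two points of an irreducible variety lie
on an irreducible curve)] -/
theorem curve_through_two_points (X : Scheme.{0}) [IsIntegral X] [IsAffine X]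
    (f : X ⟶ Spec (.of ℂ)) [LocallyOfFiniteType f] (P Q : X) (hP : height P = 0)
    (hQ : height Q = 0) (hPQ : P ≠ Q) : ∃ y : X, height y = 1 ∧ y ⤳ P ∧ y ⤳ Q := by
  classical
  have hU : IsAffineOpen (⊤ : X.Opens) := isAffineOpen_top X
  -- the affine `ℂ`-domain `A = Γ(X, ⊤)`
  let A : Type := Γ(X, ⊤)
  let ι : ℂ →+* Γ(Spec (CommRingCat.of ℂ), ⊤) := (Scheme.ΓSpecIso (CommRingCat.of ℂ)).inv.hom
  let φ : ℂ →+* A := (f.appLE ⊤ ⊤ le_top).hom.comp ι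
  letI algA : Algebra ℂ A := φ.toAlgebra
  haveI : Algebra.FiniteType ℂ A := by
    have h1 : (f.appLE ⊤ ⊤ le_top).hom.FiniteType :=
      f.finiteType_appLE (isAffineOpen_top _) hU le_top
    have h2 : ι.FiniteType :=
      RingHom.FiniteType.of_surjective _
        (Scheme.ΓSpecIso (CommRingCat.of ℂ)).symm.commRingCatIsoToRingEquiv.surjective
    exact h1.comp h2
  -- points of `X` versus primes of `A`
  let pr : X → PrimeSpectrum A := fun y => hU.primeIdealOf ⟨y, trivial⟩
  have hfp : ∀ y, hU.fromSpec (pr y) = y := fun y => hU.fromSpec_primeIdealOf ⟨y, trivial⟩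
  have hpr_inj : Function.Injective pr := fun a b h => by rw [← hfp a, ← hfp b, h]
  have hpr_surj : ∀ q : PrimeSpectrum A, ∃ y, pr y = q := fun q =>
    ⟨hU.fromSpec q, hU.fromSpec.isOpenEmbedding.injective (hfp _)⟩
  have hspec : ∀ a b : X, a ⤳ b ↔ pr a ≤ pr b := fun a b =>
    Dimension.Scheme.specializes_iff_primeIdealOf_le hU ⟨a, trivial⟩ ⟨b, trivial⟩
  have hheight : ∀ y : X, ((height y : ℕ∞) : WithBot ℕ∞) = ringKrullDim (A ⧸ (pr y).asIdeal) :=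
    fun y => Dimension.Scheme.height_eq_ringKrullDim_quotient_primeIdealOf f hU trivial
  -- closed points are maximal ideals
  have hmax : ∀ y : X, height y = 0 → (pr y).asIdeal.IsMaximal := by
    intro y hy
    have h1 : ringKrullDim (A ⧸ (pr y).asIdeal) = 0 := by
      rw [← hheight, hy]
      rfl
    haveI : Ring.KrullDimLE 0 (A ⧸ (pr y).asIdeal) := ringKrullDimZero_iff_ringKrullDim_eq_zero.mpr h1
    exact Ideal.Quotient.maximal_of_isField _ Ring.KrullDimLE.isField_of_isDomain
  have hPm := hmax P hP
  have hQm := hmax Q hQ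
  have hne : (pr P).asIdeal ≠ (pr Q).asIdeal := fun h => hPQ (hpr_inj (PrimeSpectrum.ext h))
  -- the algebraic lemma
  obtain ⟨n, hn, -⟩ := Literature.RingTheory.KrullDimension.exists_ringKrullDim_eq_and_trdeg_eq ℂ A
  obtain ⟨𝔮, h𝔮p, h𝔮P, h𝔮Q, hdim⟩ :=
    TwoPointPencil.exists_prime_le_inf_ringKrullDim_quotient_eq_one (K := ℂ) n A hn _ _ hPm hQm hne
  obtain ⟨y, hy⟩ := hpr_surj ⟨𝔮, h𝔮p⟩
  refine ⟨y, ?_, ?_, ?_⟩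
  · have h1 := hheight y
    rw [hy] at h1
    change _ = ringKrullDim (A ⧸ 𝔮) at h1
    rw [hdim] at h1
    exact_mod_cast h1
  · rw [hspec, hy]
    exact h𝔮P
  · rw [hspec, hy]
    exact h𝔮Q

/-- **Mumford's two-point lemma holds**: the named fact `mumford_smoothCurve_through_two_points`
(normalised smooth affine complex form of Mumford, *Abelian Varieties*, §6, Lemma) is a theorem:
step (1) `curve_through_two_points` fed into the reduction
`mumford_smoothCurve_through_two_points_of_curve_through_two_points` (step (2), normalisation).
[cite: MumfordAV1970, §6, Lemma (any two points of an irreducible variety lie on an irreducible curve)]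
[cite: Liu2002, Prop. 2.5.10, Cor. 4.1.30, Ex. 4.2.9, Cor. 4.3.33 (normalisation of a curve)] -/
theorem mumford_smoothCurve_through_two_points_holds : mumford_smoothCurve_through_two_points :=
  mumford_smoothCurve_through_two_points_of_curve_through_two_points
    fun X _ _ f _ P Q hP hQ hPQ => curve_through_two_points X f P Q hP hQ hPQ

end Literature.AlgebraicGeometry.Motives

end
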